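import Summits.Ventures.HSemireg.ObstructionLocusKappa

/-!
# Venture HSemireg — (S5) OBSTRUCTION LOCUS away from secant type, VII: the sign-free rank of `κ_Z` for a NEAR PAIR,
# the normal-bundle count, and «nc 2-union INJ n² + 2n − 2» (model level)

HONEST FRAMING.  Companion of `ObstructionLocusKappa.lean` (cell `pub-hsemireg`, track «S4-PUSH» (ii), seat s4-prove-2;
model, vocabulary and honest framing as there): the last closed form of STRUCTURE.md §1.1 C7(d) / §2 (S-B) «UNIFORM LEMMA
FORM (INJ n², n² + 2n − 2; pair KER 1)», typed and PROVED as finite linear algebra over an arbitrary field, every `N`.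
Nothing here constructs a variety, a normal sheaf or Bloch's `π`; the two geometric inputs of the «INJ» verdict enter as
NAMED HYPOTHESIS BINDERS (`hBloch`, `hN'`), displayed, never discharged; nothing here says that HC / HC_CM / HC_AV holds;
no Literature fact is declared or used; REGIME A is class-dead (file III).

PROVED HERE (kernel, every `N`, every near pair `S ∖ k = S' ∖ k'`, `S ≠ S'`, all non-zero signs):
* `range_kappa_pair_eq_span`, `finrank_range_kappa_pair_of_near` — **`rank κ_Z = 2p(N − p) − (p − 1)(N − p − 1) − 1`**,
  `p = |S|`; `finrank_range_kappa_pair_weil`: **`= n² + 2n − 2`** at `N = 2n`, `p = n` (6 / 13 / 22 / 33 at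
  `n = 2 / 3 / 4 / 5` = the `h¹(N) = rank` column of WEIGHT-TABLES CTRL1-n2..n5-03, ×3 engines; «INJ certified by
  rank ⌟[Z] = h¹(N)», habitat1 XCHECK-CTRL 06:19:27Z).  Mechanism: the `(N − p − 1)(p − 1)` doubly active sources hit
  sums of two PRIVATE monomials (one rank each); the singly active ones hit single monomials with exactly ONE coincidence.
* `ncUnion_normalCount`, `ncUnion_normalCount_weil`, `choose_two_succ_sub_choose_two_pred`, `two_mul_sub_pred` — the
  ARITHMETIC of the normal-bundle count of the normal-crossings union through a common point (habitat1's derivation,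
  re-derived by this seat): with `C = S ∩ S'` (`|C| = p − 1`), `V = {x_j = const : j ∈ C} ≅ E^{N−p+1}` is the coordinate
  sub-torus containing `Z`, in which `Z = D_a + D_b` is a normal-crossings divisor (`S = C + a`, `S' = C + b`);
  `X = V × E^{p−1}` and `Z ⊂ V × pt`, so the conormal sequence splits and `N_{Z/X} = N_{Z/V} ⊕ 𝒪_Z^{p−1}`;
  `h¹(𝒪_Z) = 2(N − p) − (N − p − 1) = N − p + 1` (Mayer–Vietoris for `D_a ∪ D_b`, the `H⁰`-difference map onto);
  `N_{Z/V} = 𝒪_Z(Z)`, and from `0 → 𝒪_V → 𝒪_V(Z) → 𝒪_Z(Z) → 0` with `H^*(𝒪_V(Z)) = H^*(E,𝒪(o))^{⊗2} ⊗ H^*(E^{N−p−1}, 𝒪)`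
  (Künneth; `H^*(E, 𝒪(o)) = (1, 0)`, so every `H^i(𝒪_V) → H^i(𝒪_V(Z))` is onto):
  `h¹(N_{Z/V}) = dim ker(H²(𝒪_V) ↠ H²(𝒪_V(Z))) = C(N−p+1, 2) − C(N−p−1, 2) = 2(N − p) − 1`.  Hence
  `h¹(N_Z) = (2(N−p) − 1) + (p − 1)(N − p + 1) = 2p(N−p) − (p−1)(N−p−1) − 1`: **`h¹(N_Z) = rank κ_Z` as closed forms**,
  and `(2n − 1) + (n − 1)(n + 1) = n² + 2n − 2` at the Weil rung.
* `injective_and_surjective_of_finrank_range_comp` — abstract: `rank (π ∘ r) = dim V ⟹ π injective ∧ r onto`.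
* `ncUnion_inj`, `ncUnion_inj_weil`, `single_inj` — **«nc 2-union INJ n² + 2n − 2» (and «single torus INJ n²»), MODEL
  LEVEL**: for any `K`-space `V` («`H¹(Z, N_Z)`») with maps `r : H¹(T_X) → V` («embedded obstruction `ξ ↦ ob_Z(ξ)`») and
  `π : V → monomial space` («Bloch's `π`») satisfying the NAMED HYPOTHESES (H-Bloch) `π ∘ r = κ_Z` [dictionary: Bloch 1972
  Prop. (6.8) p. 63, `β ∪ [Z₁] = (1 ⊗ d)(π ⊗ 1)(α)`, read at first order `A = ℂ[t]/t²`, `I = (t)`; `π` = contraction against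
  the local cycle class, (6.2) p. 61] and (H-N′) `dim V = 2p(N−p) − (p−1)(N−p−1) − 1` [the count above — seat-derived ×2
  (habitat1 06:19Z; this docstring), NOT a Lean theorem], `π` is injective («Z semiregular: INJ») and `r` is onto
  («class-determined: r_Z onto», the CTRL1 detector column).  For the DISJOINT near pair the same `κ_Z` has the same rank
  while `h¹ = 2p(N−p)` and `rank π = 2p(N−p) − 1` (file III «pair KER 1»): there `r` is not onto.
* `finrank_ker_parallel_pair` — the last C7(d) control, PARALLEL copies `S = S'` in the disjoint model: `dim ker π =
  (N − |S|)|S|` (`= n²`, «parallel-pair control KER n²», WEIGHT-TABLES A31).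
* `restrictPair`, `monomialMap_comp_restrictPair` — consistency with file III: in the DISJOINT model (H-Bloch) holds by
  construction, `κ_Z = π_{B_S ⊔ B_{S'}} ∘ restrictPair` with `π` file III's monomial map; so the binders of `ncUnion_inj`
  are realised non-vacuously there, and (H-N′) is exactly what separates the nc union from the disjoint one.
References (dictionary only): Bloch 1972 §4, §6 (Prop. 6.2, 6.8); cell files G2-DEFORM-SANITY.md §B.4/§C.1/§D,
WEIGHT-TABLES.md (CTRL1 rows, C7(d)), STRUCTURE.md §1.1 C7(d), §2 (S-B)/(S5).
-/

open scoped BigOperators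
open Finset

namespace Summit.Ventures.HSemireg.ObstructionLocus

variable {K : Type*} [Field K]

/-! ## The sign-free rank of `κ_Z` for a near pair -/

section Pair

variable {N : ℕ} {S S' : Finset (Fin N)} {k k' : Fin N} {ε ε' : Fin N × Fin N → K}


/-- **The range of `κ_Z` for a near pair** is spanned by the family `ncFamily` on
`T = ` monomials of singly active sources, `B = ` doubly active sources. -/
theorem range_kappa_pair_eq_span (hε : ∀ q ∈ act S, ε q ≠ 0) (hε' : ∀ q ∈ act S', ε' q ≠ 0) :
    LinearMap.range (kappa S ε + kappa S' ε')
      = Submodule.span K (Set.range (ncFamily S S' ε ε'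
          ((act S \ act S').image (tg S) ∪ (act S' \ act S).image (tg S')) (act S ∩ act S'))) := by
  apply le_antisymm
  · rw [LinearMap.range_eq_map, ← (Pi.basisFun K (Fin N × Fin N)).span_eq, Submodule.map_span,
      Submodule.span_le]
    rintro _ ⟨_, ⟨q, rfl⟩, rfl⟩
    rw [Pi.basisFun_apply, SetLike.mem_coe, kappa_pair_single, mul_one, mul_one]
    by_cases hq : q ∈ act S <;> by_cases hq' : q ∈ act S'
    · rw [if_pos hq, if_pos hq']
      exact Submodule.subset_span ⟨Sum.inr ⟨q, Finset.mem_inter.2 ⟨hq, hq'⟩⟩, rfl⟩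
    · rw [if_pos hq, if_neg hq', add_zero, single_eq_smul_single_one]
      refine Submodule.smul_mem _ _ (Submodule.subset_span ⟨Sum.inl ⟨tg S q, ?_⟩, rfl⟩)
      exact Finset.mem_union_left _ (Finset.mem_image_of_mem _ (Finset.mem_sdiff.2 ⟨hq, hq'⟩))
    · rw [if_neg hq, if_pos hq', zero_add, single_eq_smul_single_one]
      refine Submodule.smul_mem _ _ (Submodule.subset_span ⟨Sum.inl ⟨tg S' q, ?_⟩, rfl⟩)
      exact Finset.mem_union_right _ (Finset.mem_image_of_mem _ (Finset.mem_sdiff.2 ⟨hq', hq⟩))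
    · rw [if_neg hq, if_neg hq', add_zero]; exact Submodule.zero_mem _
  · rw [Submodule.span_le]
    rintro _ ⟨x, rfl⟩
    rcases x with ⟨m, hm⟩ | ⟨q, hq⟩
    · rcases Finset.mem_union.1 hm with hm | hm
      · obtain ⟨q, hq, rfl⟩ := Finset.mem_image.1 hm
        obtain ⟨hq1, hq2⟩ := Finset.mem_sdiff.1 hq
        refine ⟨Pi.single q (ε q)⁻¹, ?_⟩
        rw [kappa_pair_single, if_pos hq1, if_neg hq2, add_zero, mul_inv_cancel₀ (hε q hq1)]
        rfl
      · obtain ⟨q, hq, rfl⟩ := Finset.mem_image.1 hm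
        obtain ⟨hq1, hq2⟩ := Finset.mem_sdiff.1 hq
        refine ⟨Pi.single q (ε' q)⁻¹, ?_⟩
        rw [kappa_pair_single, if_neg hq2, if_pos hq1, zero_add, mul_inv_cancel₀ (hε' q hq1)]
        rfl
    · obtain ⟨hq1, hq2⟩ := Finset.mem_inter.1 hq
      refine ⟨Pi.single q 1, ?_⟩
      rw [kappa_pair_single, if_pos hq1, if_pos hq2, mul_one, mul_one]
      rfl

/-- **A NEAR PAIR: `rank κ_Z = 2p(N − p) − (p − 1)(N − p − 1) − 1`** (`p = |S| = |S'|`, `S ∖ k = S' ∖ k'`, `S ≠ S'`),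
whatever the non-zero signs.  This is the class-contraction rank of `Z = B_S ∪ B_{S'}` for ANY such union (the map only
sees `[Z]`); for the normal-crossings union through a common point it equals `h¹(N_Z)` (`ncUnion_normalCount`). -/
theorem finrank_range_kappa_pair_of_near (hSS' : S ≠ S') (hk : k ∈ S) (hk' : k' ∈ S')
    (he : S.erase k = S'.erase k') (hε : ∀ q ∈ act S, ε q ≠ 0) (hε' : ∀ q ∈ act S', ε' q ≠ 0) :
    Module.finrank K (LinearMap.range (kappa S ε + kappa S' ε'))
      = 2 * ((N - S.card) * S.card) - (N - S.card - 1) * (S.card - 1) - 1 := by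
  obtain ⟨hkk, hk'S, hkS'⟩ := near_aux hSS' hk hk' he
  obtain ⟨-, -, hcard⟩ := near_union_inter hSS' hk hk' he
  -- the structure of the range
  have hli : LinearIndependent K (ncFamily S S' ε ε'
      ((act S \ act S').image (tg S) ∪ (act S' \ act S).image (tg S')) (act S ∩ act S')) := by
    refine linearIndependent_ncFamily ?_ ?_ ?_ ?_ ?_
    · intro q hq
      exact (tg_not_mem_of_both hSS' (Finset.mem_inter.1 hq).1 (Finset.mem_inter.1 hq).2).1
    · intro q hq
      exact (tg_not_mem_of_both hSS' (Finset.mem_inter.1 hq).1 (Finset.mem_inter.1 hq).2).2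
    · intro q hq q' hq' h
      exact tg_injOn S (Finset.mem_coe.2 (Finset.mem_inter.1 (Finset.mem_coe.1 hq)).1)
        (Finset.mem_coe.2 (Finset.mem_inter.1 (Finset.mem_coe.1 hq')).1) h
    · intro q hq q' hq'
      exact (tg_ne_tg_of_both hSS' (Finset.mem_inter.1 hq).1 (Finset.mem_inter.1 hq).2
        (Finset.mem_inter.1 hq').2).symm
    · intro q hq; exact hε q (Finset.mem_inter.1 hq).1
  rw [range_kappa_pair_eq_span hε hε', finrank_span_eq_card hli, Fintype.card_sum, Fintype.card_coe,
    Fintype.card_coe]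
  -- the count
  have hTc : ((act S \ act S').image (tg S) ∪ (act S' \ act S).image (tg S')).card + 1
      = (act S \ act S').card + (act S' \ act S).card := by
    have h := Finset.card_union_add_card_inter ((act S \ act S').image (tg S)) ((act S' \ act S).image (tg S'))
    rw [image_sdiff_inter_image_sdiff hSS' hk hk' he, Finset.card_singleton,
      Finset.card_image_of_injOn ((tg_injOn S).mono (by simp)),
      Finset.card_image_of_injOn ((tg_injOn S').mono (by simp))] at h
    exact h
  have hA1 : (act S \ act S').card + (act S ∩ act S').card = (N - S.card) * S.card := by
    rw [Finset.card_sdiff_add_card_inter, card_act]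
  have hA2 : (act S' \ act S).card + (act S ∩ act S').card = (N - S.card) * S.card := by
    rw [Finset.inter_comm, Finset.card_sdiff_add_card_inter, card_act, hcard]
  have hB := card_act_inter_act hSS' hk hk' he
  -- the singly active witness `(k', k)` makes the first difference non-empty
  have hpos : 0 < (act S \ act S').card := Finset.card_pos.2 ⟨(k', k), by
    rw [Finset.mem_sdiff, mem_act, mem_act]; exact ⟨⟨hk'S, hk⟩, fun h => h.1 hk'⟩⟩
  omega

/-- **«nc 2-union» at the Weil rung: `rank κ_Z = n² + 2n − 2`** for a near pair of `n`-codimensional types in `E^{2n}`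
(6 / 13 / 22 / 33 at `n = 2 / 3 / 4 / 5`: WEIGHT-TABLES CTRL1-n2..n5-03 «rank ⌟[Z]», three engines), all signs. -/
theorem finrank_range_kappa_pair_weil {n : ℕ} {S S' : Finset (Fin (2 * n))} {k k' : Fin (2 * n)}
    {ε ε' : Fin (2 * n) × Fin (2 * n) → K} (hSS' : S ≠ S') (hk : k ∈ S) (hk' : k' ∈ S')
    (he : S.erase k = S'.erase k') (hS : S.card = n) (hε : ∀ q ∈ act S, ε q ≠ 0)
    (hε' : ∀ q ∈ act S', ε' q ≠ 0) :
    Module.finrank K (LinearMap.range (kappa S ε + kappa S' ε')) = n ^ 2 + 2 * n - 2 := by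
  rw [finrank_range_kappa_pair_of_near hSS' hk hk' he hε hε', hS]
  have hn : 1 ≤ n := hS ▸ Finset.card_pos.2 ⟨k, hk⟩
  obtain ⟨m, rfl⟩ : ∃ m, n = m + 1 := ⟨n - 1, by omega⟩
  have h1 : 2 * (m + 1) - (m + 1) = m + 1 := by omega
  have h2 : m + 1 - 1 = m := by omega
  rw [h1, h2]
  have h3 : (m + 1) * (m + 1) = m * m + 2 * m + 1 := by ring
  have h4 : (m + 1) ^ 2 = m * m + 2 * m + 1 := by ring
  rw [h3, h4]
  omega

end Pair

/-! ## The normal-bundle count of the normal-crossings union (arithmetic of the seat derivation) -/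

section NormalCount

/-- **`h¹(N_Z) = rank κ_Z` as closed forms.**  For the normal-crossings union `Z = B_S ∪ B_{S'}` of a near pair through a
common point (`p = |S|`, `1 ≤ p ≤ N − 1`): `h¹(N_Z) = h¹(N_{Z/V}) + (p − 1)·h¹(𝒪_Z) = (2(N − p) − 1) + (p − 1)(N − p + 1)`
(`V` = the coordinate sub-torus spanned by `Z`, `N_{Z/X} = N_{Z/V} ⊕ 𝒪_Z^{p−1}`; derivation in the file docstring) —
and this equals the `κ`-rank `2p(N − p) − (p − 1)(N − p − 1) − 1` of `finrank_range_kappa_pair_of_near`. -/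
theorem ncUnion_normalCount {N p : ℕ} (hp : 1 ≤ p) (hpN : p + 1 ≤ N) :
    (2 * (N - p) - 1) + (p - 1) * (N - p + 1) = 2 * ((N - p) * p) - (N - p - 1) * (p - 1) - 1 := by
  obtain ⟨a, rfl⟩ : ∃ a, p = a + 1 := ⟨p - 1, by omega⟩
  obtain ⟨b, hb⟩ : ∃ b, N - (a + 1) = b + 1 := ⟨N - (a + 1) - 1, by omega⟩
  rw [hb]
  have h1 : a + 1 - 1 = a := by omega
  have h2 : b + 1 - 1 = b := by omega
  rw [h1, h2]
  have h3 : (b + 1) * (a + 1) = b * a + a + b + 1 := by ring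
  have h4 : a * (b + 1 + 1) = b * a + 2 * a := by ring
  rw [h3, h4]
  omega

/-- The same count at the Weil rung `N = 2n`, `p = n`: `(2n − 1) + (n − 1)(n + 1) = n² + 2n − 2` (habitat1 06:19Z
«h¹(N) = (2n−1) + (n−1)(n+1) = n² + 2n − 2 re-derived from normal-bundle sequences»). -/
theorem ncUnion_normalCount_weil {n : ℕ} (hn : 1 ≤ n) : (2 * n - 1) + (n - 1) * (n + 1) = n ^ 2 + 2 * n - 2 := by
  obtain ⟨m, rfl⟩ : ∃ m, n = m + 1 := ⟨n - 1, by omega⟩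
  have h1 : m + 1 - 1 = m := by omega
  rw [h1]
  have h2 : m * (m + 1 + 1) = m * m + 2 * m := by ring
  have h3 : (m + 1) ^ 2 = m * m + 2 * m + 1 := by ring
  rw [h2, h3]
  omega

/-- `h¹(N_{Z/V}) = h²(𝒪_V) − h²(𝒪_V(Z)) = C(n + 1, 2) − C(n − 1, 2) = 2n − 1` at the Weil rung (`dim V = n + 1`). -/
theorem choose_two_succ_sub_choose_two_pred (n : ℕ) : (n + 1).choose 2 - (n - 1).choose 2 = 2 * n - 1 := by
  rcases n with _ | m
  · decide
  · have h1 : m + 1 - 1 = m := by omega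
    have h2 := Nat.choose_succ_succ' (m + 1) 1
    have h3 := Nat.choose_succ_succ' m 1
    simp only [Nat.reduceAdd, Nat.choose_one_right] at h2 h3
    rw [h1]
    omega

/-- `h¹(𝒪_Z) = h¹(𝒪_{B_S}) + h¹(𝒪_{B_{S'}}) − h¹(𝒪_{B_S ∩ B_{S'}}) = 2n − (n − 1) = n + 1` at the Weil rung
(Mayer–Vietoris; the `H⁰`-difference map is onto). -/
theorem two_mul_sub_pred (n : ℕ) (hn : 1 ≤ n) : 2 * n - (n - 1) = n + 1 := by omega

end NormalCount

/-! ## «nc 2-union INJ n² + 2n − 2», model level: the two geometric inputs as NAMED HYPOTHESES -/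

section Inj

/-- Abstract linear algebra: if `rank (π ∘ r) = dim V` for `r : U → V`, `π : V → W`, then `π` is injective and `r` is
onto. -/
theorem injective_and_surjective_of_finrank_range_comp {U V W : Type*} [AddCommGroup U] [Module K U]
    [AddCommGroup V] [Module K V] [FiniteDimensional K V] [AddCommGroup W] [Module K W]
    (r : U →ₗ[K] V) (π : V →ₗ[K] W)
    (h : Module.finrank K (LinearMap.range (π ∘ₗ r)) = Module.finrank K V) :
    Function.Injective π ∧ Function.Surjective r := by
  have h1 : LinearMap.range (π ∘ₗ r) = (LinearMap.range r).map π := LinearMap.range_comp r π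
  have hr : Module.finrank K (LinearMap.range r) = Module.finrank K V := by
    apply le_antisymm (Submodule.finrank_le _)
    rw [← h, h1]
    exact Submodule.finrank_map_le π (LinearMap.range r)
  have hsurj : Function.Surjective r := by
    rw [← LinearMap.range_eq_top]
    exact Submodule.eq_top_of_finrank_eq hr
  refine ⟨?_, hsurj⟩
  have h2 : LinearMap.range (π ∘ₗ r) = LinearMap.range π :=
    LinearMap.range_comp_of_range_eq_top π (LinearMap.range_eq_top.2 hsurj)
  rw [h2] at h
  have h3 := LinearMap.finrank_range_add_finrank_ker π
  have h4 : Module.finrank K (LinearMap.ker π) = 0 := by omega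
  rw [← LinearMap.ker_eq_bot]
  exact Submodule.finrank_eq_zero.1 h4

variable {N : ℕ} {S S' : Finset (Fin N)} {k k' : Fin N} {ε ε' : Fin N × Fin N → K}

/-- **(S-B)(d) «nc 2-union INJ», MODEL LEVEL, every `N`.**  Let `Z = B_S ∪ B_{S'}` be the normal-crossings union of a
near pair of coordinate sub-tori through a common point, `V` a model of `H¹(Z, N_Z)`, `r : H¹(T_X) → V` the
restriction (embedded obstruction) map and `π : V → ⊕H^{a,b}` Bloch's semiregularity map.  UNDER THE NAMED HYPOTHESES
(H-Bloch) `π ∘ r = κ_Z` (Bloch 1972 Prop. (6.8): `β ∪ [Z] = π(α)`; dictionary) and (H-N′) `dim V = 2p(N−p) −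
(p−1)(N−p−1) − 1` (the normal-bundle count `ncUnion_normalCount`; seat-derived, NOT a Lean theorem), `π` is injective
— `Z` is semiregular, «INJ» — and `r` is onto («class-determined»).  Neither hypothesis is discharged here. -/
theorem ncUnion_inj {V : Type*} [AddCommGroup V] [Module K V] [FiniteDimensional K V]
    (hSS' : S ≠ S') (hk : k ∈ S) (hk' : k' ∈ S') (he : S.erase k = S'.erase k')
    (hε : ∀ q ∈ act S, ε q ≠ 0) (hε' : ∀ q ∈ act S', ε' q ≠ 0)
    (r : (Fin N × Fin N → K) →ₗ[K] V) (π : V →ₗ[K] (Mono N → K))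
    (hBloch : π ∘ₗ r = kappa S ε + kappa S' ε')
    (hN' : Module.finrank K V = 2 * ((N - S.card) * S.card) - (N - S.card - 1) * (S.card - 1) - 1) :
    Function.Injective π ∧ Function.Surjective r :=
  injective_and_surjective_of_finrank_range_comp r π
    (by rw [hBloch, finrank_range_kappa_pair_of_near hSS' hk hk' he hε hε', hN'])

/-- **«nc 2-union INJ n² + 2n − 2» at the Weil rung** (`N = 2n`, `|S| = n`): under (H-Bloch) and
(H-N′) `h¹(N_Z) = n² + 2n − 2`, Bloch's `π` is injective and the restriction map is onto.  MODEL LEVEL (see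
`ncUnion_inj`); completes the kernel side of the UNIFORM LEMMA FORM «(INJ n², n² + 2n − 2; pair KER 1)» of
STRUCTURE.md §2 (S-B)/(S5) together with file III (`finrank_ker_single`, `finrank_ker_pair_of_near`). -/
theorem ncUnion_inj_weil {n : ℕ} {S S' : Finset (Fin (2 * n))} {k k' : Fin (2 * n)}
    {ε ε' : Fin (2 * n) × Fin (2 * n) → K} {V : Type*} [AddCommGroup V] [Module K V] [FiniteDimensional K V]
    (hSS' : S ≠ S') (hk : k ∈ S) (hk' : k' ∈ S') (he : S.erase k = S'.erase k') (hS : S.card = n)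
    (hε : ∀ q ∈ act S, ε q ≠ 0) (hε' : ∀ q ∈ act S', ε' q ≠ 0)
    (r : (Fin (2 * n) × Fin (2 * n) → K) →ₗ[K] V) (π : V →ₗ[K] (Mono (2 * n) → K))
    (hBloch : π ∘ₗ r = kappa S ε + kappa S' ε')
    (hN' : Module.finrank K V = n ^ 2 + 2 * n - 2) :
    Function.Injective π ∧ Function.Surjective r :=
  injective_and_surjective_of_finrank_range_comp r π
    (by rw [hBloch, finrank_range_kappa_pair_weil hSS' hk hk' he hS hε hε', hN'])

/-- The single sub-torus in the same words: under (H-Bloch) `π ∘ r = κ_{B_S}` and `h¹(N_{B_S}) = (N − |S|)|S|`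
(`card_blochIndex`, file III — here the count IS the basis count of the model), `π_{B_S}` is injective and `r` onto. -/
theorem single_inj {V : Type*} [AddCommGroup V] [Module K V] [FiniteDimensional K V] (S : Finset (Fin N))
    (hε : ∀ q ∈ act S, ε q ≠ 0) (r : (Fin N × Fin N → K) →ₗ[K] V) (π : V →ₗ[K] (Mono N → K))
    (hBloch : π ∘ₗ r = kappa S ε) (hN' : Module.finrank K V = (N - S.card) * S.card) :
    Function.Injective π ∧ Function.Surjective r :=
  injective_and_surjective_of_finrank_range_comp r π (by rw [hBloch, finrank_range_kappa S hε, hN'])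

end Inj


/-! ## Consistency with file III: for the DISJOINT pair, `κ_Z` factors through the `π`-model by construction -/

section Disjoint

variable {N : ℕ} (S S' : Finset (Fin N)) (ε ε' : Fin N × Fin N → K)

/-- The restriction map of the DISJOINT pair `B_S ⊔ B_{S'}`: `H¹(T_X) → H¹(N_{B_S}) ⊕ H¹(N_{B_{S'}})`, `ξ ↦ (ξ|, ξ|)`,
in the bases `θ_q` and `dz̄_i ⊗ ∂_k` (file III's index types). -/
def restrictPair : (Fin N × Fin N → K) →ₗ[K] (BlochIndex S ⊕ BlochIndex S' → K) :=
  LinearMap.funLeft K K (Sum.elim (fun p : BlochIndex S => p.1) (fun p : BlochIndex S' => p.1))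

/-- `restrictPair` on a basis vector `θ_q`: the (at most two) basis vectors indexed by `q`. -/
theorem restrictPair_single (q : Fin N × Fin N) (c : K) :
    restrictPair S S' (Pi.single q c)
      = (if h : q ∈ act S then
            Pi.single (M := fun _ => K) (Sum.inl (⟨q, mem_act.1 h⟩ : BlochIndex S) : BlochIndex S ⊕ BlochIndex S') c
          else 0)
        + (if h : q ∈ act S' then
            Pi.single (M := fun _ => K) (Sum.inr (⟨q, mem_act.1 h⟩ : BlochIndex S') : BlochIndex S ⊕ BlochIndex S') c
          else 0) := by
  funext j
  rw [Pi.add_apply, restrictPair, LinearMap.funLeft_apply]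
  rcases j with p | p
  · rw [Sum.elim_inl]
    have h2 : (if h : q ∈ act S' then
        Pi.single (M := fun _ => K) (Sum.inr (⟨q, mem_act.1 h⟩ : BlochIndex S') : BlochIndex S ⊕ BlochIndex S') c
        else 0) (Sum.inl p) = 0 := by
      split_ifs with h
      · exact Pi.single_eq_of_ne Sum.inl_ne_inr _
      · rfl
    rw [h2, add_zero]
    by_cases hpq : p.1 = q
    · have h : q ∈ act S := mem_act.2 (hpq ▸ p.2)
      have hp : (⟨q, mem_act.1 h⟩ : BlochIndex S) = p := Subtype.ext hpq.symm
      rw [dif_pos h, hp, hpq, Pi.single_eq_same, Pi.single_eq_same]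
    · rw [Pi.single_eq_of_ne hpq]
      split_ifs with h
      · rw [Pi.single_eq_of_ne]
        exact fun h' => hpq (congrArg Subtype.val (Sum.inl.inj h'))
      · rfl
  · rw [Sum.elim_inr]
    have h1 : (if h : q ∈ act S then
        Pi.single (M := fun _ => K) (Sum.inl (⟨q, mem_act.1 h⟩ : BlochIndex S) : BlochIndex S ⊕ BlochIndex S') c
        else 0) (Sum.inr p) = 0 := by
      split_ifs with h
      · exact Pi.single_eq_of_ne Sum.inr_ne_inl _
      · rfl
    rw [h1, zero_add]
    by_cases hpq : p.1 = q
    · have h : q ∈ act S' := mem_act.2 (hpq ▸ p.2)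
      have hp : (⟨q, mem_act.1 h⟩ : BlochIndex S') = p := Subtype.ext hpq.symm
      rw [dif_pos h, hp, hpq, Pi.single_eq_same, Pi.single_eq_same]
    · rw [Pi.single_eq_of_ne hpq]
      split_ifs with h
      · rw [Pi.single_eq_of_ne]
        exact fun h' => hpq (congrArg Subtype.val (Sum.inr.inj h'))
      · rfl

/-- **(H-Bloch) holds by construction in the disjoint model of file III**: `κ_Z = π_{B_S ⊔ B_{S'}} ∘ r`, with `π` the
monomial map of file III on the disjoint pair (signs `ε, ε'` read through the index types) and `r = restrictPair`.
Hence `rank κ_Z ≤ rank π = 2p(N−p) − 1` there (`finrank_ker_pair_of_near`) while `h¹ = 2p(N−p)`: for the DISJOINT near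
pair `r` is not onto and (H-N′) fails — the two binders of `ncUnion_inj` are not idle. -/
theorem monomialMap_comp_restrictPair :
    (monomialMap (Sum.elim (blochTarget S) (blochTarget S'))
        (Sum.elim (fun p : BlochIndex S => ε p.1) (fun p : BlochIndex S' => ε' p.1))) ∘ₗ restrictPair S S'
      = kappa S ε + kappa S' ε' := by
  apply LinearMap.pi_ext
  intro q c
  rw [LinearMap.comp_apply, restrictPair_single, map_add, kappa_pair_single]
  congr 1
  · by_cases h : q ∈ act S
    · rw [dif_pos h, if_pos h, monomialMap_single]; rfl
    · rw [dif_neg h, if_neg h, map_zero]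
  · by_cases h : q ∈ act S'
    · rw [dif_pos h, if_pos h, monomialMap_single]; rfl
    · rw [dif_neg h, if_neg h, map_zero]

end Disjoint

/-! ## The last control of C7(d): PARALLEL copies `S = S'` in the disjoint model («KER n²») -/

section Parallel

variable {N : ℕ}

/-- **Parallel copies** (`S = S'`, two disjoint translates of the SAME coordinate sub-torus; file III left it cited): in
the disjoint `π`-model every monomial is shared, so `dim ker π_{B_S ⊔ (B_S + t)} = (N − |S|)|S|` (`= n²` at the Weil rung —
the «parallel-pair control KER n²» of WEIGHT-TABLES A31; the kernel is the anti-diagonal «differences»). -/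
theorem finrank_ker_parallel_pair (S : Finset (Fin N)) {ε : BlochIndex S ⊕ BlochIndex S → K} (hε : ∀ j, ε j ≠ 0) :
    Module.finrank K (LinearMap.ker (monomialMap (Sum.elim (blochTarget S) (blochTarget S)) ε))
      = (N - S.card) * S.card := by
  have h := finrank_ker_monomialMap (Sum.elim (blochTarget S) (blochTarget S)) hε
  have himg : (Finset.univ.image (Sum.elim (blochTarget S) (blochTarget S))).card = (N - S.card) * S.card := by
    have he : Finset.univ.image (Sum.elim (blochTarget S) (blochTarget S)) = Finset.univ.image (blochTarget S) := by
      ext m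
      simp only [Finset.mem_image, Finset.mem_univ, true_and, Sum.exists, Sum.elim_inl, Sum.elim_inr, or_self]
    rw [he, Finset.card_image_of_injective _ (blochTarget_injective S), Finset.card_univ, card_blochIndex]
  rw [himg, Fintype.card_sum, card_blochIndex] at h
  omega

end Parallel

end Summit.Ventures.HSemireg.ObstructionLocus
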